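import Mathlib.Analysis.Analytic.Basic
import Mathlib.Analysis.Calculus.ContDiff.Basic
import Mathlib.Analysis.Calculus.FDeriv.Analytic
import Mathlib.Analysis.InnerProductSpace.PiL2
import HarnessLib

/-!
# Morrey's theorem: smooth solutions of analytic quasilinear elliptic systems are real-analytic (named fact)

Topic `Literature/Analysis/PDE`. ONE named fact (D-0014), the interior analyticity theorem for
solutions of non-linear elliptic systems with real-analytic data — C. B. Morrey Jr., *On the
analyticity of the solutions of analytic non-linear elliptic systems of partial differential
equations, I–II*, Amer. J. Math. 80 (1958) 198–218, 219–237 (earlier, for linear systems,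
Morrey–Nirenberg, Comm. Pure Appl. Math. 10 (1957); for `C^∞` solutions also A. Friedman, J. Math.
Mech. 7 (1958) 43–59; book form: Morrey, *Multiple Integrals in the Calculus of Variations* (1966),
§6.7) — in the SPECIAL CASE that suffices for its first consumer in the tree, Müller zum Hagen's
theorem on the analyticity of stationary vacuum metrics
(`Literature.Geometry.Lorentzian.mullerZumHagen1970_analytic_of_timelikeKilling`, through its
gauge-fixed half `Literature.Geometry.Lorentzian.mullerZumHagen1970_analytic_in_stationaryHarmonicGauge`):
second order, quasilinear, with DIAGONAL (scalar) principal part,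

  `∑_{i,j} a^{ij}(x, u, Du) ∂ᵢ∂ⱼ u = b(x, u, Du)`,   `u : U → ℝᴺ`, `U ⊆ ℝⁿ` open,

`a^{ij}`, `b` real-analytic in all their arguments on an open set containing the `1`-jet graph of
`u`, and `(a^{ij}(x, u(x), Du(x)))` positive definite at every `x ∈ U` (ellipticity; for a scalar
principal part acting alike on all components this is ellipticity in every sense — Petrovskii,
Agmon–Douglis–Nirenberg). Conclusion: a solution `u` of class `C^∞` on `U` is real-analytic on `U`.
(The printed theorems allow general non-linear elliptic systems and finite differentiability
`C^{2,μ}`; the `C^∞` hypothesis makes the statement a special case of each of the cited sources.)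
-- TODO(general form): fully non-linear `F(x, u, Du, D²u) = 0` elliptic in the sense of the
linearisation, ADN systems, `C^{k,μ}` solutions, analyticity up to the boundary (Part II).

Rendering: `x ∈ EuclideanSpace ℝ (Fin n)`, values `u x ∈ (Fin N → ℝ)`, `Du = fderiv ℝ u x`, second
derivatives `∂ᵢ∂ⱼu(x) = iteratedFDeriv ℝ 2 u x ![eᵢ, eⱼ]` on the standard basis
`eᵢ = EuclideanSpace.single i 1`; the coefficients are functions on
`ℝⁿ × ℝᴺ × (ℝⁿ →L ℝᴺ)` (Mathlib's `AnalyticOnNhd ℝ` on an open set `O`); positivity of the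
principal symbol as `0 < ∑ᵢⱼ a^{ij} ξᵢ ξⱼ` for `ξ ≠ 0`.

Not proved here (Morrey's proof: `L^p`/Schauder estimates for the linearised system and an
induction on the order of derivatives with factorial bounds, cf. the tree's
`Literature/Analysis/Calculus/AnalyticOfFDerivBound.lean`, `AnalyticCauchyEstimates.lean`).

## References

* [Morrey1958AnalyticityI] C. B. Morrey Jr., Amer. J. Math. 80 (1958) 198–218 (Part I, interior),
  main theorem of Part I.
* [Friedman1958Regularity] A. Friedman, J. Math. Mech. 7 (1958) 43–59, Thm. 1.
* [KrantzParks2002] S. G. Krantz, H. R. Parks, *A Primer of Real Analytic Functions* (2002), §2.2.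
-/

noncomputable section

open Set

namespace Literature.Analysis.PDE

/-- NAMED FACT — **Morrey 1958 (interior analyticity for analytic quasilinear elliptic systems with
scalar principal part).** Let `U ⊆ ℝⁿ` be open, `u : ℝⁿ → ℝᴺ` of class `C^∞` on `U`, and let
`a = (a^{ij})`, `b = (b^A)` be real-analytic on an open set `O ⊆ ℝⁿ × ℝᴺ × (ℝⁿ →L ℝᴺ)` containing
`(x, u(x), Du(x))` for all `x ∈ U`. Assume ellipticity, `∑ᵢⱼ a^{ij}(x, u(x), Du(x)) ξᵢ ξⱼ > 0` for
`x ∈ U`, `ξ ≠ 0`, and the equations `∑ᵢⱼ a^{ij}(x, u(x), Du(x)) ∂ᵢ∂ⱼu(x) = b(x, u(x), Du(x))` on `U`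
(the same scalar operator on every component). Then `u` is real-analytic on `U`. "The solutions of
analytic non-linear elliptic systems … are analytic in the interior" (Morrey 1958, Part I), here in
the special case: second order, quasilinear, diagonal principal part, `C^∞` solutions.
[cite: Morrey1958AnalyticityI, Part I, main theorem (interior analyticity)] [cite: Friedman1958Regularity, Thm. 1] -/
def Morrey1958_analyticOnNhd_of_quasilinearElliptic : Prop :=
  ∀ (n N : ℕ) (U : Set (EuclideanSpace ℝ (Fin n)))
    (O : Set (EuclideanSpace ℝ (Fin n) × (Fin N → ℝ) × (EuclideanSpace ℝ (Fin n) →L[ℝ] (Fin N → ℝ))))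
    (u : EuclideanSpace ℝ (Fin n) → (Fin N → ℝ))
    (a : EuclideanSpace ℝ (Fin n) × (Fin N → ℝ) × (EuclideanSpace ℝ (Fin n) →L[ℝ] (Fin N → ℝ)) →
      (Fin n → Fin n → ℝ))
    (b : EuclideanSpace ℝ (Fin n) × (Fin N → ℝ) × (EuclideanSpace ℝ (Fin n) →L[ℝ] (Fin N → ℝ)) →
      (Fin N → ℝ)),
    IsOpen U → IsOpen O → ContDiffOn ℝ (⊤ : ℕ∞) u U →
    (∀ x ∈ U, (x, u x, fderiv ℝ u x) ∈ O) →
    AnalyticOnNhd ℝ a O → AnalyticOnNhd ℝ b O →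
    (∀ x ∈ U, ∀ ξ : Fin n → ℝ, ξ ≠ 0 →
      0 < ∑ i, ∑ j, a (x, u x, fderiv ℝ u x) i j * ξ i * ξ j) →
    (∀ x ∈ U, ∑ i, ∑ j, a (x, u x, fderiv ℝ u x) i j •
        iteratedFDeriv ℝ 2 u x ![EuclideanSpace.single i 1, EuclideanSpace.single j 1] =
      b (x, u x, fderiv ℝ u x)) →
    AnalyticOnNhd ℝ u U

end Literature.Analysis.PDE

end
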